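import Summits.KontsevichZagierPeriods.KontsevichZagierPeriods.Theorems.LinRedNormalFormArrangementNormalFormStubRebaseSimpleZeroNestedDiffFrameA

/-!
# Stub `stub_rebaseSimpleZeroTwo`, part `HPar1` (crux `ArrangementNormalForm`, line `janus-bands`)
— brick `NestedDiffE2Corner`

**Type A with the wall touching the bottom at a corner** (the second non-dominated configuration
of the edge expansion, E2 route). In the normalised frame (`κ`, `τ` constant, `cᵢ` of slope
`λ ≠ 0`, base pole `r`, wall `ρ = cᵢ(r)`) let the clean nest `A(y) < tᵢ < tⱼ < τ` lie ABOVE the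
wall, its bottom meeting the wall only at a corner `(y₀, ρ)` of the base cell transversally:
`tᵢ − ρ > α |y − y₀|` on the domain (`α > 0`). Then `1/(tᵢ − ρ)` has a LOGARITHMIC singularity
along the edge `y = y₀` and the two pieces of the edge expansion converge by the log-cone estimate
`RebaseNest.integrableOn_logCone` (`|φ| ≤ K/((tᵢ − ρ)(tⱼ − ρ))` on `{α |y − y₀| < t_l − ρ}`), as
soon as the base pole and the inner letter keep a positive distance from the piece and the outer
letter is dominated by the wall distance (`tⱼ − ρ ≤ Cκ |tⱼ − κ|`: either `κ ≤ ρ`, or `κ` at a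
positive distance). The letter piece has constant letters (`RebaseDiff.good_any`), the frame piece
is `RebaseDiff.good_frameA`. Main theorem `RebaseDiff.good_coreA_corner`, registered as
`rebaseSimpleZero_nestedDiffACorner`.

References: M. Kontsevich, D. Zagier, *Periods* (2001), §1.2, rules (1b), (2).
-/

noncomputable section

open Set MeasureTheory MvPolynomial
open Literature.NumberTheory.Transcendental Literature.ModelTheory.ExponentialFields

namespace Summit.KontsevichZagierPeriods.ArrangementNormalForm.JanusBands

namespace RebaseDiff

open SeparatePos RebasePos RebaseZero RebaseNest

variable {m' : ℕ} {i j : Fin 2}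

/-- A product over the two fibre values, read on the ordered pair `(i, j)`. -/
theorem mul_pair (hij : i ≠ j) (g : Fin 2 → ℝ) : g 0 * g 1 = g i * g j := by
  rw [← Fin.prod_univ_two, prod_pair hij]

/-- **Convergence at a corner.** On a bounded measurable set on which `tᵢ − ρ > α |y − y₀| > 0`
(`α > 0`) and `tᵢ < tⱼ`, a function bounded by `K/((tᵢ − ρ)(tⱼ − ρ))` and a.e.-strongly
measurable is absolutely integrable (the log-cone estimate `RebaseNest.integrableOn_logCone`). -/
theorem integrableOn_corner (hij : i ≠ j) {D : Set (Fin (0 + 1 + 2) → ℝ)} (hDm : MeasurableSet D)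
    (hbd : Bornology.IsBounded D) {φ : (Fin (0 + 1 + 2) → ℝ) → ℝ}
    (hφ : AEStronglyMeasurable φ (volume.restrict D)) (ρ : ℚ) (y₀ α K : ℝ) (hα : 0 < α)
    (hW : ∀ z ∈ D, 0 < |yv z - y₀| ∧ α * |yv z - y₀| < tv z i - ρ ∧ tv z i < tv z j)
    (hK : ∀ z ∈ D, |φ z| ≤ K / ((tv z i - ρ) * (tv z j - ρ))) : IntegrableOn φ D := by
  obtain ⟨Rb, hRb⟩ := hbd.exists_norm_le
  have hl : ∀ z ∈ D, ∀ l : Fin 2, α * |yv z - y₀| < tv z l - ρ ∧ tv z l - ρ < Rb + |(ρ : ℝ)| + 1 := by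
    intro z hz l
    obtain ⟨-, h1, h2⟩ := hW z hz
    have hb : |tv z l| ≤ Rb := (norm_le_pi_norm z (tIdx l)).trans (hRb z hz)
    have hb' := le_abs_self (tv z l)
    have hρ' := neg_abs_le (ρ : ℝ)
    refine ⟨?_, by linarith⟩
    rcases fin_two_eq_or hij l with rfl | rfl
    · exact h1
    · exact h1.trans (by linarith)
  refine integrableOn_logCone (y₀ := y₀) (t₀ := (ρ : ℝ)) (K := K) (R := Rb + |y₀|) (S := Rb + |(ρ : ℝ)| + 1)
    hDm hφ hα (fun z hz => ?_) (fun z hz => ?_)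
  · have hy : |yv (k := 2) z| ≤ Rb := (norm_le_pi_norm z (yIdx 2)).trans (hRb z hz)
    have e0 : z 0 = yv (k := 2) z := rfl
    have e1 : z 1 = tv (k := 2) z 0 := rfl
    have e2 : z 2 = tv (k := 2) z 1 := rfl
    rw [e0, e1, e2]
    refine ⟨⟨(hW z hz).1, ?_⟩, hl z hz 0, hl z hz 1⟩
    calc |yv (k := 2) z - y₀| ≤ |yv (k := 2) z| + |y₀| := abs_sub _ _
      _ ≤ Rb + |y₀| := by linarith
  · have e1 : z 1 = tv (k := 2) z 0 := rfl
    have e2 : z 2 = tv (k := 2) z 1 := rfl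
    rw [e1, e2, mul_pair hij (fun l => tv (k := 2) z l - ρ)]
    exact hK z hz

/-- **Type A with the wall touching the bottom at a corner, normalised form.** A clean nest
`A(y) < tᵢ < tⱼ < τ` (`τ` constant) with the literal integrand `K/((y − r)(tᵢ − cᵢ(y))(tⱼ − κ))`
(`cᵢ` of slope `λ ≠ 0`, `κ` constant, simple base pole `r`, wall `ρ = cᵢ(r)`) which lies above
the wall with `tᵢ − ρ > α |y − y₀| > 0` on the domain (`α > 0`: the wall meets the closed piece
only along the edge `y = y₀, tᵢ = ρ`), with `|y − r| ≥ m_y > 0`, `tᵢ ≠ cᵢ(y)` and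
`tⱼ − ρ ≤ Cκ |tⱼ − κ|` on the domain, is good for `GG 0 2 2`: the letter piece of the
(non-dominated) edge expansion of `tᵢ` to the slope `0` about `r` converges by the log-cone
estimate (hence so does the frame piece, the difference), the letter piece has constant letters,
the frame piece is `good_frameA`.
[Kontsevich–Zagier 2001, §1.2, rules (1b), (2)] -/
theorem good_coreA_corner (s : KZ.IntegralRep (0 + 1 + 2)) (hij : i ≠ j) (M : Fin m' → Cf) (A : Cf) (τ : ℚ)
    (T : BData) (p : MvPolynomial (Fin 0) ℚ) (a : Fin 2 → Option Cf) (ci cj : Cf)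
    (hi : a i = some ci) (hj : a j = some cj) (hcj : cj.1 (Fin.last 0) = 0) (h1 : T.n₁ = 0)
    (hn : T.n₂ = 1) (hlam : ci.1 (Fin.last 0) ≠ 0) (hbd : Bornology.IsBounded s.domain)
    (hdom : s.domain = gDom 0 2 m' M (nlo i A) (nhi j (mk 0 τ)))
    (hint : EqOn s.integrand (glitB T p a) s.domain) (ρ : ℚ)
    (hρ : ρ = ci.2 - (0 - ci.1 (Fin.last 0)) * T.ℓ₂.2) (y₀ α my Cκ : ℝ) (hα : 0 < α) (hmy : 0 < my)
    (hW : ∀ z ∈ s.domain, 0 < |yv z - y₀| ∧ α * |yv z - y₀| < tv z i - ρ)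
    (hregy : ∀ z ∈ s.domain, my ≤ |yv z - T.ℓ₂.2|)
    (hne : ∀ z ∈ s.domain, tv z i ≠ ev ci (yv z))
    (hκ : ∀ z ∈ s.domain, tv z j - ρ ≤ Cκ * |tv z j - ev cj (yv z)|) : Good 2 (KZ.of s) := by
  subst hρ
  set lam : ℚ := ci.1 (Fin.last 0) with hlamdef
  set r : ℚ := T.ℓ₂.2 with hrdef
  set ρ : ℚ := ci.2 - (0 - lam) * r with hρdef
  have hrot : rot ci 0 r = mk 0 ρ := rfl
  have mD := fun z => mem_nDom hij M A (mk 0 τ) z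
  have hcjv : ∀ y : ℝ, ev cj y = cj.2 := fun y => by rw [ev, hcj, Rat.cast_zero, zero_mul, zero_add]
  have hy : ∀ z ∈ s.domain, yv z ≠ r := fun z hz h => by
    have := hregy z hz; rw [h, sub_self, abs_zero] at this; exact absurd this (not_le.2 hmy)
  -- above the wall: `0 < tᵢ − ρ < tⱼ − ρ`
  have hR : ∀ z ∈ s.domain, 0 < tv z i - ρ ∧ tv z i < tv z j := fun z hz => by
    obtain ⟨h0, hlt⟩ := hW z hz
    obtain ⟨-, -, h2, -⟩ := (mD z).1 (hdom ▸ hz)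
    exact ⟨lt_of_le_of_lt (mul_nonneg hα.le (abs_nonneg _)) hlt, h2⟩
  have hRj : ∀ z ∈ s.domain, 0 < tv z j - ρ := fun z hz => by
    have := hR z hz; linarith [this.1, this.2]
  have hCκ : ∀ z ∈ s.domain, 1 / |tv z j - cj.2| ≤ Cκ / (tv z j - ρ) := fun z hz => by
    have h := hκ z hz
    rw [hcjv] at h
    have hpos := hRj z hz
    have hne' : 0 < |tv z j - (cj.2 : ℝ)| := by
      rcases (abs_nonneg (tv z j - (cj.2 : ℝ))).lt_or_eq with h' | h'
      · exact h'
      · rw [← h', mul_zero] at h; linarith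
    rw [div_le_div_iff₀ hne' hpos, one_mul]
    exact h
  have hRv : ∀ z, tv z i - ev (rot ci 0 r) (yv z) = tv z i - ρ := fun z => by
    rw [hrot, ev_mk, Rat.cast_zero, zero_mul, zero_add]
  have hsa := s.isSemialgebraic_domain
  have hDm : MeasurableSet s.domain := KZ.IntegralRep.measurableSet_domain_holds s
  -- the literal integrand and its absolute value
  have hlit : ∀ z ∈ s.domain, s.integrand z = Kc T p * (1 / (yv z - r)) *
      ((1 / (tv z i - ev ci (yv z))) * (1 / (tv z j - cj.2))) := fun z hz => by
    rw [hint hz, glitB_two T p a hij ci cj hi hj h1 hn, hcjv]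
  have hf_abs : ∀ z ∈ s.domain, |s.integrand z| = |Kc T p| * (1 / |yv z - r|) *
      ((1 / |tv z i - ev ci (yv z)|) * (1 / |tv z j - cj.2|)) := fun z hz => by
    rw [hlit z hz]; simp only [abs_mul, abs_div, abs_one]
  have hL_abs : ∀ z ∈ s.domain, |facL i ci 0 r z| = |tv z i - ev ci (yv z)| / (tv z i - ρ) := fun z hz => by
    rw [facL, hRv, abs_div, abs_of_pos (hR z hz).1]
  have hWij : ∀ z ∈ s.domain, 0 < |yv z - y₀| ∧ α * |yv z - y₀| < tv z i - ρ ∧ tv z i < tv z j := fun z hz =>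
    ⟨(hW z hz).1, (hW z hz).2, (hR z hz).2⟩
  -- convergence of the letter piece
  have hI₁ : IntegrableOn (fun z => s.integrand z * facL i ci 0 r z) s.domain := by
    have hsa₁ := IsSemialgebraicFunOn.mul_holds s.isSemialgebraicFunOn_integrand (isSemialgebraicFunOn_facL hsa i ci 0 r)
    refine integrableOn_corner hij hDm hbd (KZ.aestronglyMeasurable_of_isSemialgebraicFunOn hsa₁ hDm) ρ y₀ α
      (|Kc T p| / my * Cκ) hα hWij fun z hz => ?_
    have hPi : |tv z i - ev ci (yv z)| ≠ 0 := abs_ne_zero.2 (sub_ne_zero.2 (hne z hz))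
    have hρ0 := (hR z hz).1
    have hρj := hRj z hz
    have hyr : 0 < |yv z - (r : ℝ)| := abs_pos.2 (sub_ne_zero.2 (hy z hz))
    rw [abs_mul, hf_abs z hz, hL_abs z hz]
    calc |Kc T p| * (1 / |yv z - ↑r|) * (1 / |tv z i - ev ci (yv z)| * (1 / |tv z j - ↑cj.2|)) *
          (|tv z i - ev ci (yv z)| / (tv z i - ↑ρ))
        = |Kc T p| * (1 / |yv z - ↑r|) * (1 / |tv z j - ↑cj.2|) * (1 / (tv z i - ↑ρ)) := by field_simp
      _ ≤ |Kc T p| * (1 / my) * (Cκ / (tv z j - ρ)) * (1 / (tv z i - ↑ρ)) := by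
          have k1 : 1 / |yv z - (r : ℝ)| ≤ 1 / my := one_div_le_one_div_of_le hmy (hregy z hz)
          refine mul_le_mul_of_nonneg_right ?_ (by positivity)
          exact mul_le_mul (mul_le_mul_of_nonneg_left k1 (abs_nonneg _)) (hCκ z hz) (by positivity) (by positivity)
      _ = |Kc T p| / my * Cκ / ((tv z i - ↑ρ) * (tv z j - ↑ρ)) := by field_simp
  -- convergence of the frame piece: it is the difference `f − f · facL`
  have hI₂ : IntegrableOn (fun z => s.integrand z * facF i ci 0 r z) s.domain := by
    refine (s.integrableOn.sub hI₁).congr_fun (fun z hz => ?_) hDm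
    have hRz : tv z i - ev (rot ci 0 r) (yv z) ≠ 0 := by rw [hRv]; exact (hR z hz).1.ne'
    show s.integrand z - s.integrand z * facL i ci 0 r z = s.integrand z * facF i ci 0 r z
    have h := facL_add_facF i ci 0 r z hRz
    calc s.integrand z - s.integrand z * facL i ci 0 r z
        = s.integrand z * (facL i ci 0 r z + facF i ci 0 r z) - s.integrand z * facL i ci 0 r z := by
          rw [h, mul_one]
      _ = s.integrand z * facF i ci 0 r z := by ring
  -- rule (1b) with the convergence just proved
  obtain ⟨s₁, s₂, hd₁, hd₂, hi₁, hi₂, hrel⟩ := split_of_integrable s _ _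
    (IsSemialgebraicFunOn.mul_holds s.isSemialgebraicFunOn_integrand (isSemialgebraicFunOn_facL hsa i ci 0 r))
    (IsSemialgebraicFunOn.mul_holds s.isSemialgebraicFunOn_integrand (isSemialgebraicFunOn_facF hsa i ci 0 r))
    hI₁ hI₂ (fun z hz => by
      have hRz : tv z i - ev (rot ci 0 r) (yv z) ≠ 0 := by
        rw [hRv]; exact (hR z hz).1.ne'
      show s.integrand z = s.integrand z * facL i ci 0 r z + s.integrand z * facF i ci 0 r z
      rw [← mul_add, facL_add_facF i ci 0 r z hRz, mul_one])
  refine good_of_rel3 hrel ?_ ?_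
  · -- the letter piece: constant letters `ρ, κ`
    refine good_any s₁ M T.L T.e p T.ℓ₁ T.ℓ₂ (Function.update a i (some (rot ci 0 r))) (nlo i A)
      (nhi j (mk 0 τ)) h1 hn ⟨0, fun l c hc => ?_⟩ (hd₁ ▸ hbd) (hd₁.trans hdom) fun z hz => ?_
    · rcases fin_two_eq_or hij l with rfl | rfl
      · rw [Function.update_self] at hc; cases hc; rfl
      · rw [Function.update_of_ne hij.symm, hj] at hc; cases hc; exact hcj
    · rw [hd₁] at hz
      rw [hi₁]
      show s.integrand z * facL i ci 0 r z = glitB T p (Function.update a i (some (rot ci 0 r))) z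
      rw [hint hz, glitB_update_letter T p a i ci (rot ci 0 r) hi z (hne z hz), facL]
  · -- the frame piece
    exact good_frameA s₂ hij M A τ T p a ci cj hi hj hcj h1 hn hlam (hd₂ ▸ hbd) (hd₂.trans hdom)
      (fun z hz => by rw [hi₂, Pi.mul_apply, hint (hd₂ ▸ hz)]) (fun z hz => hne z (hd₂ ▸ hz))
      (fun z hz h => by
        have := (hR z (hd₂ ▸ hz)).1; rw [← sub_eq_zero, hRv] at h; linarith)
      (fun z hz => hy z (hd₂ ▸ hz))

end RebaseDiff

/-- **Registered brick `rebaseSimpleZero_nestedDiffACorner` of the part `HPar1` (stub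
`stub_rebaseSimpleZeroTwo`, line `janus-bands`): type A with the wall touching the bottom at a
corner, normalised form.** A clean nest `A(y) < tᵢ < tⱼ < τ` (`τ` constant; literal `GS 0 2`
integrand with simple base pole `r = ℓ₂.2`, inner letter of slope `λ ≠ 0`, outer letter constant)
lying above the wall `tᵢ = ρ = cᵢ(r)` of the edge expansion with `tᵢ − ρ > α |y − y₀| > 0` on the
domain, the base pole and the inner letter at a positive distance and the outer letter dominated
by the wall distance (`tⱼ − ρ ≤ Cκ |tⱼ − κ|`), is congruent modulo `KZ.relations` to the subgroup
generated by `GG 0 2 2` (`RebaseDiff.good_coreA_corner`: the two pieces of the expansion converge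
by the log-cone estimate). [Kontsevich–Zagier 2001, §1.2] -/
theorem rebaseSimpleZero_nestedDiffACorner (m' : ℕ) (i j : Fin 2) (s : KZ.IntegralRep (0 + 1 + 2)) (hij : i ≠ j) (M : Fin m' → (Fin (0 + 1) → ℚ) × ℚ) (A : (Fin (0 + 1) → ℚ) × ℚ) (τ : ℚ) (T : RebaseZero.BData) (p : MvPolynomial (Fin 0) ℚ) (a : Fin 2 → Option ((Fin (0 + 1) → ℚ) × ℚ)) (ci cj : (Fin (0 + 1) → ℚ) × ℚ) (hi : a i = some ci) (hj : a j = some cj) (hcj : cj.1 (Fin.last 0) = 0) (h1 : T.n₁ = 0) (hn : T.n₂ = 1) (hlam : ci.1 (Fin.last 0) ≠ 0) (hbd : Bornology.IsBounded s.domain) (hdom : s.domain = SeparatePos.gDom 0 2 m' M (RebaseNest.nlo i A) (RebaseNest.nhi j (RebaseZero.mk 0 τ))) (hint : EqOn s.integrand (RebaseZero.glitB T p a) s.domain) (ρ : ℚ) (hρ : ρ = ci.2 - (0 - ci.1 (Fin.last 0)) * T.ℓ₂.2) (y₀ α my mi Cκ : ℝ) (hα : 0 < α) (hmy : 0 < my)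 (hmi : 0 < mi) (hW : ∀ z ∈ s.domain, 0 < |RebaseZero.yv z - y₀| ∧ α * |RebaseZero.yv z - y₀| < RebaseZero.tv z i - ρ) (hregy : ∀ z ∈ s.domain, my ≤ |RebaseZero.yv z - T.ℓ₂.2|) (hregi : ∀ z ∈ s.domain, mi ≤ |RebaseZero.tv z i - RebaseZero.ev ci (RebaseZero.yv z)|) (hκ : ∀ z ∈ s.domain, RebaseZero.tv z j - ρ ≤ Cκ * |RebaseZero.tv z j - RebaseZero.ev cj (RebaseZero.yv z)|) : ∃ c ∈ AddSubgroup.closure (SeparatePos.GGset 0 2 2), KZ.of s - c ∈ KZ.relations :=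
  RebaseDiff.good_coreA_corner s hij M A τ T p a ci cj hi hj hcj h1 hn hlam hbd hdom hint ρ hρ y₀ α my Cκ hα hmy hW hregy
    (fun z hz h => by
      have := hregi z hz
      rw [h, sub_self, abs_zero] at this
      exact absurd this (not_le.2 hmi)) hκ

end Summit.KontsevichZagierPeriods.ArrangementNormalForm.JanusBands
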